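import Summits.CriticalPhenomena.CardyFormulaZ2.Theorems.CardyComplexConeEdgePrecompactUFRSStrands

/-!
# When the run of the second dynamics meets the incoming whisker: follow, then split or exit
(line `qkz-strip-boundary-arm` of crux `CardyComplexCone.EdgePrecompact`, stmt-CriticalPhenomena-11387;
item 3 of the road map for the uniform forward response stability "UFRS", module docstring of
`Theorems/CardyComplexConeEdgePrecompactUniformForwardResponseStability.lean`, case (A) of
`splitStrands`)

In case (A) of `splitStrands` (`…EdgePrecompactUFRSStrands.lean`) the run `R₁ = O₁ e (0, T]` of
the second dynamics from the last synchronised corner `e = O₀ c₀ m` shares no corner with the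
outgoing run `O₀ c₀ (m, n]`, but it MAY meet the incoming whisker `W₀ = O₀ c₀ [0, m)` (the road
map's "three pairwise dart-disjoint strands" is true only up to this). This file gives the
FORWARD analysis of such a meeting (`run_whisker_trichotomy`, registered sub-goal, formulated by
worker W1 of lead c1 and proved here): EITHER `R₁` avoids the whisker, OR after its FIRST contact
`O₁ e j = O₀ c₀ i` (`i < m`) it follows the whisker — the two dynamics agree — up to a last index
`t < m`, `O₁ e (j + (s - i)) = O₀ c₀ s` for `i ≤ s ≤ t`, where EITHER the target edge of `O₀ c₀ t`
has different status in `β₀` and `β₁` (a SPLIT off the whisker: a discrepancy edge, hence on the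
discrete boundary by `ufrs_discrepancyEdges`), OR the status is the same, the run ends exactly
there (`j + (t - i) = T`) and leaves the inner faces of the second datum at the whisker's next
corner (`O₁ e (T + 1) = O₀ c₀ (t + 1)`, a FACE-type exit: by `orbit_exit_or_stuck` at a marked
edge). It cannot follow the whisker back into `e`: the run `O₁ e [0, T]` is simple
(`cornerOrbit_injOn_run`). The BACKWARD analysis (what precedes the first contact: a merge at a
discrepancy edge, or a passage through `c₀`) is `whiskerContact`
(`…EdgePrecompactUFRSMerge.lean`).

References: S. Smirnov, C. R. Acad. Sci. Paris 333 (2001), §2; G. Grimmett, *Percolation* (1999),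
§11.2.
-/

namespace Summit.CriticalPhenomena.CardyFormulaZ2.Cruxes.EdgePrecompact.QkzStripBoundaryArm

open MeasureTheory Filter Set Metric
open scoped Topology BigOperators Pointwise
open Literature.Probability.LatticeModels Literature.Probability.Percolation
open Literature.Probability.RandomPlanarGeometry (DobrushinDomain)
open Summit.CriticalPhenomena.CardyFormulaZ2.Theses.CardyComplexCone

noncomputable section

/-- **The run meets the whisker: avoid, or follow then split or exit** (registered sub-goal
`run_whisker_trichotomy` of stmt-CriticalPhenomena-11387; case (A) of `splitStrands`, forward
analysis). Data: the whisker-and-run `O₀ c₀ [0, n]` with targets off `I` before `n`, the corner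
`e = O₀ c₀ m` (`m ≤ n`), a run end `T` of the `β₁`-orbit of `e`. CONCLUSION: either
`O₁ e [1, T]` avoids `O₀ c₀ [0, m)`, or there are a first contact `O₁ e j = O₀ c₀ i` and a last
index `t ∈ [i, m)` of agreement along the whisker, at which the target edge is a discrepancy
edge, or (same status) the run ends, stepping out of the inner faces at `O₀ c₀ (t + 1)`. -/
theorem run_whisker_trichotomy : ∀ (β₀ β₁ : BondConfig (Site 2)) (In₁ : Site 2 → Prop) (I : Set (Sym2 (Site 2))) (c₀ : Site 2 × Fin 4) (m n T : ℕ), m ≤ n → (∀ i < n, cTgt (cornerOrbit β₀ c₀ i) ∉ I) → (∀ i < T, cTgt (cornerOrbit β₁ (cornerOrbit β₀ c₀ m) i) ∉ I ∧ In₁ (cFace (cornerOrbit β₁ (cornerOrbit β₀ c₀ m) (i + 1)))) → (cTgt (cornerOrbit β₁ (cornerOrbit β₀ c₀ m) T) ∈ I ∨ ¬ In₁ (cFace (cornerOrbit β₁ (cornerOrbit β₀ c₀ m) (T + 1)))) → (∀ j, 1 ≤ j → j ≤ T → ∀ i < m, cornerOrbit β₁ (cornerOrbit β₀ c₀ m)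 j ≠ cornerOrbit β₀ c₀ i) ∨ (∃ j i t : ℕ, 1 ≤ j ∧ j ≤ T ∧ i ≤ t ∧ t < m ∧ j + (t - i) ≤ T ∧ cornerOrbit β₁ (cornerOrbit β₀ c₀ m) j = cornerOrbit β₀ c₀ i ∧ (∀ j', 1 ≤ j' → j' < j → ∀ i' < m, cornerOrbit β₁ (cornerOrbit β₀ c₀ m) j' ≠ cornerOrbit β₀ c₀ i') ∧ (∀ s, i ≤ s → s ≤ t → cornerOrbit β₁ (cornerOrbit β₀ c₀ m) (j + (s - i)) = cornerOrbit β₀ c₀ s) ∧ ((¬ (cTgt (cornerOrbit β₀ c₀ t) ∈ β₀ ↔ cTgt (cornerOrbit β₀ c₀ t) ∈ β₁)) ∨ ((cTgt (cornerOrbit β₀ c₀ t) ∈ β₀ ↔ cTgt (cornerOrbit β₀ c₀ t) ∈ β₁) ∧ j + (t - i) = T ∧ cornerOrbit β₁ (cornerOrbit β₀ c₀ m) (T + 1) = cornerOrbit β₀ c₀ (t + 1) ∧ ¬ In₁ (cFace (cornerOrbit β₀ c₀ (t + 1)))))) := by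
  intro β₀ β₁ In₁ I c₀ m n T hmn hW hrun hend
  classical
  by_cases hex : ∃ j, (1 ≤ j ∧ j ≤ T) ∧ ∃ i, i < m ∧
      cornerOrbit β₁ (cornerOrbit β₀ c₀ m) j = cornerOrbit β₀ c₀ i
  swap
  · left
    intro j hj hjT i hi h
    exact hex ⟨j, ⟨hj, hjT⟩, i, hi, h⟩
  right
  obtain ⟨⟨hj1, hjT⟩, i, him, hEq⟩ := Nat.find_spec hex
  have hmin : ∀ j' < Nat.find hex, ¬ ((1 ≤ j' ∧ j' ≤ T) ∧ ∃ i, i < m ∧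
      cornerOrbit β₁ (cornerOrbit β₀ c₀ m) j' = cornerOrbit β₀ c₀ i) := fun j' hj' => Nat.find_min hex hj'
  generalize Nat.find hex = j at hj1 hjT hEq hmin
  have hfirst : ∀ j', 1 ≤ j' → j' < j → ∀ i' < m,
      cornerOrbit β₁ (cornerOrbit β₀ c₀ m) j' ≠ cornerOrbit β₀ c₀ i' :=
    fun j' h1 hj' i' hi' h => hmin j' hj' ⟨⟨h1, le_trans hj'.le hjT⟩, i', hi', h⟩
  -- agreement predicate along the whisker
  set P : ℕ → Prop := fun s => i ≤ s ∧ s < m ∧ j + (s - i) ≤ T ∧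
    ∀ r, i ≤ r → r ≤ s → cornerOrbit β₁ (cornerOrbit β₀ c₀ m) (j + (r - i)) = cornerOrbit β₀ c₀ r with hP
  have hPi : P i := by
    refine ⟨le_rfl, him, by simpa using hjT, fun r h1 h2 => ?_⟩
    have hr : r = i := le_antisymm h2 h1
    subst hr
    simpa using hEq
  set t := Nat.findGreatest P (m - 1) with ht
  have hPt : P t := Nat.findGreatest_spec (P := P) (by omega) hPi
  have htmax : ∀ k, t < k → k ≤ m - 1 → ¬ P k := fun k h1 h2 => Nat.findGreatest_is_greatest h1 h2
  obtain ⟨hit, htm, htT, hagree⟩ := hPt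
  have hRt : cornerOrbit β₁ (cornerOrbit β₀ c₀ m) (j + (t - i)) = cornerOrbit β₀ c₀ t := hagree t hit le_rfl
  -- simplicity of the run
  have hsimple : ∀ a b : ℕ, a ≤ T → b ≤ T →
      cornerOrbit β₁ (cornerOrbit β₀ c₀ m) a = cornerOrbit β₁ (cornerOrbit β₀ c₀ m) b → a = b :=
    fun a b ha hb h => cornerOrbit_injOn_run hrun hend ha hb h
  refine ⟨j, i, t, hj1, hjT, hit, htm, htT, hEq, hfirst, hagree, ?_⟩
  by_cases hiff : (cTgt (cornerOrbit β₀ c₀ t) ∈ β₀ ↔ cTgt (cornerOrbit β₀ c₀ t) ∈ β₁)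
  swap
  · exact Or.inl hiff
  right
  -- same status: the second dynamics follows the whisker one more step
  have hstep : cornerOrbit β₁ (cornerOrbit β₀ c₀ m) (j + (t - i) + 1) = cornerOrbit β₀ c₀ (t + 1) := by
    show nextCorner β₁ (cornerOrbit β₁ (cornerOrbit β₀ c₀ m) (j + (t - i))) = nextCorner β₀ (cornerOrbit β₀ c₀ t)
    rw [hRt]
    exact (nextCorner_congr_of_iff hiff).symm
  -- the run must end exactly at `j + (t - i)`
  have hTeq : j + (t - i) = T := by
    by_contra hne
    have hlt : j + (t - i) + 1 ≤ T := by omega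
    rcases Nat.lt_or_ge (t + 1) m with ht1 | ht1
    · -- `t + 1` would still be an agreement index
      refine htmax (t + 1) (Nat.lt_succ_self t) (by omega) ⟨by omega, ht1, ?_, fun r h1 h2 => ?_⟩
      · have : j + (t + 1 - i) = j + (t - i) + 1 := by omega
        rw [this]; exact hlt
      · rcases Nat.lt_or_ge r (t + 1) with hr | hr
        · exact hagree r h1 (by omega)
        · have hr' : r = t + 1 := le_antisymm h2 hr
          subst hr'
          have : j + (t + 1 - i) = j + (t - i) + 1 := by omega
          rw [this]; exact hstep
    · -- `t + 1 = m`: the run would return to `e`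
      have htm' : t + 1 = m := le_antisymm htm ht1
      have hback : cornerOrbit β₁ (cornerOrbit β₀ c₀ m) (j + (t - i) + 1) =
          cornerOrbit β₁ (cornerOrbit β₀ c₀ m) 0 := by
        rw [hstep, htm']; rfl
      have := hsimple _ _ hlt (Nat.zero_le T) hback
      omega
  refine ⟨hiff, hTeq, ?_, ?_⟩
  · rw [← hTeq]; exact hstep
  · -- the run end is an exit from the inner faces (the target at `T` is a whisker target, off `I`)
    have hend' := hend
    rw [← hTeq] at hend'
    rcases hend' with hinI | hout
    · rw [hRt] at hinI
      exact absurd hinI (hW t (by omega))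
    · rwa [hstep] at hout

end

end Summit.CriticalPhenomena.CardyFormulaZ2.Cruxes.EdgePrecompact.QkzStripBoundaryArm
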